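import Summits.BirchSwinnertonDyer.Rank2.Chi8FloorLatticeEngine
import HarnessLib

/-!
# The χ₈-floor kernel, Part E of 8 — §TwistDoorProved, §ElementaryDischarges

Planner p2 GEN 40–42 kernel `Chi8Floor` v10 (cell bsd-rank2, HOME/p2/g43/lean/Chi8Floor_v10.lean, sha bc257584; 60 theorems, `lean check` rc 0 / 0 sorry),
split into ≤400-line tree files `Rank2/Chi8Floor{Certificate,ConductorLevel,TwistDoor,LatticeEngine,TwistDoorProved,PeriodFree,TwistDoorFinal,KatoFree}`
(A–H, a linear import chain) by the lead star-p1 GEN 18 at the planner's LANDING ASK.  The mathematical overview, the honest framing (Barrier B1: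
`ord_{T=0} L₂` is the 2-adic analytic order, never `r_an`; BSD is not proved) and the references are in Part A's module docstring
(`Rank2/Chi8FloorCertificate.lean`); every theorem below carries its own `[cite: …]` tags.  Theorems only; no definition, no named fact, no instance.
[cite: MazurTateTeitelbaum1986Invent, §I.14 Proposition (p. 20)] [cite: Kato2004Asterisque, Thm. 18.4 (p. 281)] [cite: GreenbergLNM1716, §5 (p. 181)]
[cite: Stevens1989, Lemma (5.4)]
-/

noncomputable section

open PowerSeries WeierstrassCurve CongruenceSubgroup Filter
open Literature.NumberTheory.EllipticCurves Literature.NumberTheory.EllipticCurves.ModularForms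
open Literature.Barriers.BirchSwinnertonDyer

namespace Summit.BirchSwinnertonDyer.Rank2

section TwistDoorProved

/-! ### The twisted door with the engine hypothesis discharged (forced-zero / real-lattice regime)

`hM` of `rank_eq_two_of_twistedEighth` is replaced by its PROOF (`norm_qnrHalfSum_le_half_of_realLattice`)
from: `L(E₀,1) = 0`; the forced zeros of the four odd twists, typed as the vanishing of the `χ₋₄`- and
`χ₋₈`-twisted symbol sums of `f₀` AND of `F = f₀ ⊗ χ_q` (Birch: `= τ·L(E₀^{(−1)},1), τ'·L(E₀^{(−2)},1)`,
resp. `L(E₀^{(−q)},1), L(E₀^{(−2q)},1)`; all four have root number `−1` when `N₀ ≡ 1 (mod 8)`,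
`q ≡ 1 (mod 4)`, `χ_q(N₀) = 1`); a real Gauss sum (`q ≡ 1 (mod 4)`); and the non-rectangular period
lattice (`Δ(E₀) < 0`). The twist formula `{∞,r}_F = g(χ)⁻¹ ∑_u χ(u){∞, r + u/q}_{f₀}`
(`modularSymbol_charTwist`) transports the realness of `{∞,1/8}_F` to `Z_ε`. -/

variable {N₀ : ℕ} [NeZero N₀] {q : ℕ} [NeZero q] (L : ℕ) [NeZero L]
variable {W : WeierstrassCurve ℚ} [W.IsElliptic] [W.IsGloballyMinimal]

/-- **`hM` from forced zeros**: the QNR half-sum bound of the twisted door, derived from the lattice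
engine with the realness of `Z_ε = g(χ){∞,1/8}_F` read off the twisted form `F`.
[cite: MazurTateTeitelbaum1986Invent, §I.8] [cite: CremonaAlgorithms1997, §2.8] -/
theorem norm_qnrHalfSum_le_half_of_forcedZeros (hN : N₀ ∣ L) (hm : q ^ 2 ∣ L)
    {χ : DirichletCharacter ℂ q} (hχ : χ.IsQuadratic) (hχp : χ.IsPrimitive)
    {f₀ : CuspForm (Gamma0 N₀) 2} (hf₀ : IsNewform0 f₀) (hQ₀ : coeffField f₀ = ⊥) (hN2 : ¬ 2 ∣ N₀)
    (hL2 : ¬ 2 ∣ L) (hF : IsNewform0 (charTwist L hN hm hχ f₀)) (hQF : coeffField (charTwist L hN hm hχ f₀) = ⊥)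
    (ε : ZMod q → ℤ) (hε : ∀ u, χ u = (ε u : ℂ)) (hε0 : ε 0 = 0) (hεodd : ∀ u ≠ 0, Odd (ε u))
    (hq : q.Prime) (hq2 : q ≠ 2) (hqN : ¬ q ∣ N₀) {a : ℤ} (ha : cuspCoeff f₀ q = a)
    (hL0 : modularSymbol f₀ 0 = 0)
    (h4 : modularSymbol f₀ (1 / 4) - modularSymbol f₀ (3 / 4) = 0)
    (h8m : modularSymbol f₀ (1 / 8) + modularSymbol f₀ (3 / 8) - modularSymbol f₀ (5 / 8)
      - modularSymbol f₀ (7 / 8) = 0)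
    (h4F : modularSymbol (charTwist L hN hm hχ f₀) (1 / 4) - modularSymbol (charTwist L hN hm hχ f₀) (3 / 4) = 0)
    (h8F : modularSymbol (charTwist L hN hm hχ f₀) (1 / 8) + modularSymbol (charTwist L hN hm hχ f₀) (3 / 8)
      - modularSymbol (charTwist L hN hm hχ f₀) (5 / 8) - modularSymbol (charTwist L hN hm hχ f₀) (7 / 8) = 0)
    (hg : (gaussSum χ (ZMod.stdAddChar (N := q))).im = 0)
    (hΛ : ∀ z ∈ periodLattice f₀, z.im = 0 → ∃ k : ℤ, z = k * (plusPeriod f₀ : ℂ)) :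
    ‖((∑ u : ZMod q, (1 - (ε u : ℚ)) * ratPlusSymbol f₀ (1 / 8 + twistShift u)
        - ratPlusSymbol f₀ (1 / 8) : ℚ) : ℚ_[2])‖ ≤ 2⁻¹ := by
  have h0 := im_modularSymbol_eighths_eq_zero hf₀ hQ₀ hN2 h4 h8m
  have hq8 := im_modularSymbol_div_eight_eq_zero (f := f₀) (hq.odd_of_ne_two hq2) h0
  have hF0 := im_modularSymbol_eighths_eq_zero hF hQF hL2 h4F h8F
  -- `Z_ε = g(χ) {∞, 1/8}_F`
  set g : ℂ := gaussSum χ (ZMod.stdAddChar (N := q)) with hgdef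
  have hgne : g ≠ 0 := gaussSum_stdAddChar_ne_zero_of_isPrimitive hχp
  have htw := modularSymbol_charTwist L hN hm hχ f₀ (1 / 8)
  have hZeq : ∑ u : ZMod q, (ε u : ℂ) * modularSymbol f₀ (1 / 8 + twistShift u) =
      g * modularSymbol (charTwist L hN hm hχ f₀) (1 / 8) := by
    rw [htw, ← mul_assoc, mul_inv_cancel₀ hgne, one_mul]
    exact Finset.sum_congr rfl fun u _ ↦ by rw [hε u]
  have hZ : (∑ u : ZMod q, (ε u : ℂ) * modularSymbol f₀ (1 / 8 + twistShift u)).im = 0 := by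
    rw [hZeq, Complex.mul_im, hg, hF0.1, mul_zero, zero_mul, add_zero]
  exact norm_qnrHalfSum_le_half_of_realLattice hf₀ hQ₀ hN2 hq hq2 hqN ha ε hε0 hεodd hL0 h0.1 hq8 hZ hΛ

/-- **THE PROVED DOOR** (forced-zero / real-lattice regime; e.g. `E₀` = 433a1 and every prime
`q ≡ 1 (mod 4)` with `a_q(E₀)` odd and `χ_q(433) = 1`). For `E = E₀^{(q)}` (global minimal model `W`,
newform `F = f₀ ⊗ χ_q`, good ordinary at `2`): unit period ratio, `a_q(E₀)` odd, `[q/8]⁺_{f₀}` a `2`-adic unit,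
`[1/8]⁺_{f₀} ∈ ℤ₍₂₎`, `L(E₀,1) = 0`, the forced zeros (`χ₋₄`/`χ₋₈`-twisted symbol sums of `f₀` and of `F`
vanish), a real Gauss sum and a non-rectangular `Λ_{f₀}` — PLUS Kato's bound at `2` and planted
`rank E(ℚ) ≥ 2` ⇒ `rank E(ℚ) = corank Sel_{2^∞}(E) = ord_{T=0} L₂(E,T) = 2`, `corank Ш(E)[2^∞] = 0`.
[cite: Kato2004Asterisque, Thm. 18.4 (p. 281)] [cite: MazurTateTeitelbaum1986Invent, §I.8 and §I.14] -/
theorem rank_eq_two_of_twistedEighth_forcedZeros (hN : N₀ ∣ L) (hm : q ^ 2 ∣ L)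
    {χ : DirichletCharacter ℂ q} (hχ : χ.IsQuadratic) (hχe : χ.Even) (hχp : χ.IsPrimitive)
    {f₀ : CuspForm (Gamma0 N₀) 2} (hf₀ : IsNewform0 f₀) (hQ₀ : coeffField f₀ = ⊥) (hN2 : ¬ 2 ∣ N₀)
    (hL2 : ¬ 2 ∣ L) (hord : IsOrdinaryAt W 2) (hF : IsNewformOf W (charTwist L hN hm hχ f₀))
    (ε : ZMod q → ℤ) (hε : ∀ u, χ u = (ε u : ℂ)) (hε0 : ε 0 = 0) (hεodd : ∀ u ≠ 0, Odd (ε u))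
    (hper : ∃ u : ℚ, ‖(u : ℚ_[2])‖ = 1 ∧
      (u : ℂ) * (plusPeriod (charTwist L hN hm hχ f₀) : ℂ) * gaussSum χ (ZMod.stdAddChar (N := q)) =
        (plusPeriod f₀ : ℂ))
    (hq : q.Prime) (hq2 : q ≠ 2) (hqN : ¬ q ∣ N₀) {a : ℤ} (ha : cuspCoeff f₀ q = a) (hodd : Odd a)
    (h8q : ‖((ratPlusSymbol f₀ ((q : ℚ) / 8) : ℚ) : ℚ_[2])‖ = 1)
    (h8 : ‖((ratPlusSymbol f₀ (1 / 8) : ℚ) : ℚ_[2])‖ ≤ 1)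
    (hL0 : modularSymbol f₀ 0 = 0)
    (h4 : modularSymbol f₀ (1 / 4) - modularSymbol f₀ (3 / 4) = 0)
    (h8m : modularSymbol f₀ (1 / 8) + modularSymbol f₀ (3 / 8) - modularSymbol f₀ (5 / 8)
      - modularSymbol f₀ (7 / 8) = 0)
    (h4F : modularSymbol (charTwist L hN hm hχ f₀) (1 / 4) - modularSymbol (charTwist L hN hm hχ f₀) (3 / 4) = 0)
    (h8F : modularSymbol (charTwist L hN hm hχ f₀) (1 / 8) + modularSymbol (charTwist L hN hm hχ f₀) (3 / 8)
      - modularSymbol (charTwist L hN hm hχ f₀) (5 / 8) - modularSymbol (charTwist L hN hm hχ f₀) (7 / 8) = 0)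
    (hg : (gaussSum χ (ZMod.stdAddChar (N := q))).im = 0)
    (hΛ : ∀ z ∈ periodLattice f₀, z.im = 0 → ∃ k : ℤ, z = k * (plusPeriod f₀ : ℂ))
    (hKato : kato_selmerCorank_le_order_padicLFunction_allPrimes W 2 (f := charTwist L hN hm hχ f₀))
    (hrank : 2 ≤ W.mordellWeilRank) :
    W.mordellWeilRank = 2 ∧ W.selmerCorank 2 = 2 ∧ W.shaCorank 2 = 0 ∧
      (padicLFunction (charTwist L hN hm hχ f₀) (unitRoot W 2 : ℚ_[2])).order = (2 : ℕ) :=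
  rank_eq_two_of_twistedEighth L hN hm hχ hχe hχp hf₀ hQ₀ hord hF ε hε hper hq hq2 hqN ha hodd h8q h8
    (norm_qnrHalfSum_le_half_of_forcedZeros L hN hm hχ hχp hf₀ hQ₀ hN2 hL2 hF.1 hF.coeffField_eq_bot
      ε hε hε0 hεodd hq hq2 hqN ha hL0 h4 h8m h4F h8F hg hΛ) hKato hrank

/-- **Unconditional analytic half of the proved door**: same regime, no Kato, no planted points:
`L(E,1) = 0 ⇒ ord_{T=0} L₂(E,T) ≤ 2` for `E = E₀^{(q)}`. [cite: MazurTateTeitelbaum1986Invent, §I.8 and §I.14] -/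
theorem order_padicLFunction_le_two_of_twistedEighth_forcedZeros (hN : N₀ ∣ L) (hm : q ^ 2 ∣ L)
    {χ : DirichletCharacter ℂ q} (hχ : χ.IsQuadratic) (hχe : χ.Even) (hχp : χ.IsPrimitive)
    {f₀ : CuspForm (Gamma0 N₀) 2} (hf₀ : IsNewform0 f₀) (hQ₀ : coeffField f₀ = ⊥) (hN2 : ¬ 2 ∣ N₀)
    (hL2 : ¬ 2 ∣ L) (hord : IsOrdinaryAt W 2) (hF : IsNewformOf W (charTwist L hN hm hχ f₀))
    (hL : W.entireLFunction 1 = 0)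
    (ε : ZMod q → ℤ) (hε : ∀ u, χ u = (ε u : ℂ)) (hε0 : ε 0 = 0) (hεodd : ∀ u ≠ 0, Odd (ε u))
    (hper : ∃ u : ℚ, ‖(u : ℚ_[2])‖ = 1 ∧
      (u : ℂ) * (plusPeriod (charTwist L hN hm hχ f₀) : ℂ) * gaussSum χ (ZMod.stdAddChar (N := q)) =
        (plusPeriod f₀ : ℂ))
    (hq : q.Prime) (hq2 : q ≠ 2) (hqN : ¬ q ∣ N₀) {a : ℤ} (ha : cuspCoeff f₀ q = a) (hodd : Odd a)
    (h8q : ‖((ratPlusSymbol f₀ ((q : ℚ) / 8) : ℚ) : ℚ_[2])‖ = 1)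
    (h8 : ‖((ratPlusSymbol f₀ (1 / 8) : ℚ) : ℚ_[2])‖ ≤ 1)
    (hL0 : modularSymbol f₀ 0 = 0)
    (h4 : modularSymbol f₀ (1 / 4) - modularSymbol f₀ (3 / 4) = 0)
    (h8m : modularSymbol f₀ (1 / 8) + modularSymbol f₀ (3 / 8) - modularSymbol f₀ (5 / 8)
      - modularSymbol f₀ (7 / 8) = 0)
    (h4F : modularSymbol (charTwist L hN hm hχ f₀) (1 / 4) - modularSymbol (charTwist L hN hm hχ f₀) (3 / 4) = 0)
    (h8F : modularSymbol (charTwist L hN hm hχ f₀) (1 / 8) + modularSymbol (charTwist L hN hm hχ f₀) (3 / 8)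
      - modularSymbol (charTwist L hN hm hχ f₀) (5 / 8) - modularSymbol (charTwist L hN hm hχ f₀) (7 / 8) = 0)
    (hg : (gaussSum χ (ZMod.stdAddChar (N := q))).im = 0)
    (hΛ : ∀ z ∈ periodLattice f₀, z.im = 0 → ∃ k : ℤ, z = k * (plusPeriod f₀ : ℂ)) :
    (padicLFunction (charTwist L hN hm hχ f₀) (unitRoot W 2 : ℚ_[2])).order ≤ (2 : ℕ) :=
  order_padicLFunction_le_two_of_twistedEighth L hN hm hχ hχe hχp hf₀ hQ₀ hord hF hL ε hε hper hq hq2 hqN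
    ha hodd h8q h8
    (norm_qnrHalfSum_le_half_of_forcedZeros L hN hm hχ hχp hf₀ hQ₀ hN2 hL2 hF.1 hF.coeffField_eq_bot
      ε hε hε0 hεodd hq hq2 hqN ha hL0 h4 h8m h4F h8F hg hΛ)

end TwistDoorProved

section ElementaryDischarges

/-! ### Elementary discharges of three side hypotheses of the proved door

`hg` (the Gauss sum of an even quadratic primitive character is real), `ε` (a quadratic character is
`ℤ`-valued, `0` at `0` and odd on units) and `h8q` (`[m/8]⁺ = ±[1/8]⁺` for odd `m` when `[0]⁺ = 0`). -/

/-- **An even primitive quadratic Dirichlet character mod a prime has a real Gauss sum**: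
`g(χ)² = χ(−1)·q = q > 0` (`gaussSum_sq`) forces `im g(χ) = 0`. [folklore] -/
theorem im_gaussSum_eq_zero_of_isQuadratic_of_even {q : ℕ} [NeZero q] {χ : DirichletCharacter ℂ q}
    (hχ : χ.IsQuadratic) (hχp : χ.IsPrimitive) (hχe : χ.Even) (hq : q.Prime) :
    (gaussSum χ (ZMod.stdAddChar (N := q))).im = 0 := by
  haveI : Fact q.Prime := ⟨hq⟩
  have hne : χ ≠ 1 := by
    intro h
    have h1 : χ.conductor = q := hχp
    rw [h, DirichletCharacter.conductor_one] at h1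
    exact hq.one_lt.ne' h1.symm
  have hsq := gaussSum_sq hne hχ (ZMod.isPrimitive_stdAddChar q)
  have hm1 : χ (-1) = 1 := hχe
  rw [hm1, one_mul, ZMod.card] at hsq
  set g : ℂ := gaussSum χ (ZMod.stdAddChar (N := q)) with hgdef
  have him : (g * g).im = 0 := by rw [← pow_two, hsq]; exact Complex.natCast_im q
  have hre : (g * g).re = q := by rw [← pow_two, hsq]; exact Complex.natCast_re q
  rw [Complex.mul_im] at him
  rw [Complex.mul_re] at hre
  have h0 : g.re * g.im = 0 := by linarith
  rcases mul_eq_zero.mp h0 with h | h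
  · exfalso
    rw [h, zero_mul, zero_sub] at hre
    have hqpos : (0 : ℝ) < q := by exact_mod_cast Nat.pos_of_ne_zero (NeZero.ne q)
    nlinarith [mul_self_nonneg g.im]
  · exact h

/-- **A quadratic character mod a prime is `ℤ`-valued, `0` at `0` and odd (`±1`) elsewhere.** [folklore] -/
theorem exists_int_eq_of_isQuadratic {q : ℕ} [NeZero q] {χ : DirichletCharacter ℂ q}
    (hχ : χ.IsQuadratic) (hq : q.Prime) :
    ∃ ε : ZMod q → ℤ, (∀ u, χ u = (ε u : ℂ)) ∧ ε 0 = 0 ∧ ∀ u ≠ 0, Odd (ε u) := by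
  classical
  haveI : Fact q.Prime := ⟨hq⟩
  have hval : ∀ u : ZMod q, ∃ e : ℤ, χ u = (e : ℂ) ∧ (χ u = 0 → e = 0) ∧ (χ u ≠ 0 → Odd e) := by
    intro u
    rcases hχ u with h | h | h
    · exact ⟨0, by rw [h, Int.cast_zero], fun _ ↦ rfl, fun h' ↦ absurd h h'⟩
    · refine ⟨1, by rw [h, Int.cast_one], fun h' ↦ ?_, fun _ ↦ odd_one⟩
      rw [h] at h'
      exact absurd h' one_ne_zero
    · refine ⟨-1, by rw [h, Int.cast_neg, Int.cast_one], fun h' ↦ ?_, fun _ ↦ odd_neg_one⟩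
      rw [h] at h'
      exact absurd h' (neg_ne_zero.mpr one_ne_zero)
  choose ε hε h0 hodd using hval
  refine ⟨ε, hε, h0 0 (MulChar.map_nonunit χ not_isUnit_zero), fun u hu ↦ hodd u ?_⟩
  exact ((Ne.isUnit hu).map χ).ne_zero

variable {N : ℕ} [NeZero N] {f : CuspForm (Gamma0 N) 2}

/-- **`[m/8]⁺ = ±[1/8]⁺` for odd `m`** at odd level with `[0]⁺_f = 0` (periodicity and
`[3/8]⁺ = [5/8]⁺ = −[1/8]⁺`, `[7/8]⁺ = [1/8]⁺`). [cite: MazurTateTeitelbaum1986Invent, §I.4 (4.2)] -/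
theorem ratPlusSymbol_div_eight_eq_or_eq_neg (hf : IsNewform0 f) (hQ : coeffField f = ⊥)
    (h2N : ¬ 2 ∣ N) {a₂ : ℤ} (ha₂ : cuspCoeff f 2 = a₂) (h0 : ratPlusSymbol f 0 = 0) {m : ℕ}
    (hm : Odd m) :
    ratPlusSymbol f ((m : ℚ) / 8) = ratPlusSymbol f (1 / 8) ∨
      ratPlusSymbol f ((m : ℚ) / 8) = -ratPlusSymbol f (1 / 8) := by
  have hcast : ∀ r : ℚ, ((ratPlusSymbol f r : ℚ) : ℝ) = normalizedPlusSymbol f r :=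
    fun r ↦ ratCast_ratPlusSymbol_holds hf hQ r
  have h0' : normalizedPlusSymbol f 0 = 0 := by rw [← hcast 0, h0, Rat.cast_zero]
  obtain ⟨-, -, h38, h58, h78⟩ := normalizedPlusSymbol_eighths_of_zero hf h2N ha₂ h0'
  have hsplit : ((m : ℚ) / 8) = ((m % 8 : ℕ) : ℚ) / 8 + ((m / 8 : ℕ) : ℤ) := by
    have h' : ((8 * (m / 8) + m % 8 : ℕ) : ℚ) = (m : ℚ) := by exact_mod_cast Nat.div_add_mod m 8
    simp only [Int.cast_natCast]
    generalize m / 8 = d at h' ⊢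
    generalize m % 8 = r at h' ⊢
    push_cast at h'
    linarith
  rw [hsplit, ratPlusSymbol_add_intCast_eq]
  obtain ⟨t, ht⟩ := hm
  have hc : m % 8 = 1 ∨ m % 8 = 3 ∨ m % 8 = 5 ∨ m % 8 = 7 := by omega
  have key : ∀ r : ℚ, normalizedPlusSymbol f r = normalizedPlusSymbol f (1 / 8) ∨
      normalizedPlusSymbol f r = -normalizedPlusSymbol f (1 / 8) →
      ratPlusSymbol f r = ratPlusSymbol f (1 / 8) ∨ ratPlusSymbol f r = -ratPlusSymbol f (1 / 8) := by
    intro r hr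
    rcases hr with hr | hr
    · left
      apply Rat.cast_injective (α := ℝ)
      rw [hcast, hcast, hr]
    · right
      apply Rat.cast_injective (α := ℝ)
      rw [hcast, Rat.cast_neg, hcast, hr]
  rcases hc with hc | hc | hc | hc <;> rw [hc] <;> apply key <;> norm_num
  · exact Or.inr h38
  · exact Or.inr h58
  · exact Or.inl h78

/-- Norm form: `‖[m/8]⁺‖₂ = ‖[1/8]⁺‖₂` for odd `m`. [folklore] -/
theorem norm_ratPlusSymbol_div_eight_eq (hf : IsNewform0 f) (hQ : coeffField f = ⊥)
    (h2N : ¬ 2 ∣ N) {a₂ : ℤ} (ha₂ : cuspCoeff f 2 = a₂) (h0 : ratPlusSymbol f 0 = 0) {m : ℕ}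
    (hm : Odd m) :
    ‖((ratPlusSymbol f ((m : ℚ) / 8) : ℚ) : ℚ_[2])‖ = ‖((ratPlusSymbol f (1 / 8) : ℚ) : ℚ_[2])‖ := by
  rcases ratPlusSymbol_div_eight_eq_or_eq_neg hf hQ h2N ha₂ h0 hm with h | h
  · rw [h]
  · rw [h, Rat.cast_neg, norm_neg]

/-- `[0]⁺_f = 0` from `{∞,0}_f = 0`. [folklore] -/
theorem ratPlusSymbol_zero_eq_zero_of_modularSymbol (hf : IsNewform0 f) (hQ : coeffField f = ⊥)
    (hL0 : modularSymbol f 0 = 0) : ratPlusSymbol f 0 = 0 := by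
  have hpos : 0 < plusPeriod f := IsNewform0.plusPeriod_pos_holds hf hQ
  have hreal := cuspCoeff_im_eq_zero_of_coeffField_eq_bot hQ
  have h1 := ratCast_ratPlusSymbol_mul_plusPeriod f hf hQ 0
  rw [plusSymbol_eq_re_holds f hreal, hL0, Complex.zero_re, Complex.ofReal_zero] at h1
  have h2 : ((ratPlusSymbol f 0 : ℚ) : ℂ) = 0 :=
    (mul_eq_zero.mp h1).resolve_right (by exact_mod_cast hpos.ne')
  exact_mod_cast h2

end ElementaryDischarges

end Summit.BirchSwinnertonDyer.Rank2

end
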